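import Literature.NumberTheory.GaloisRepresentations.ProjectiveType
import Literature.NumberTheory.GaloisRepresentations.SerreProp16PGL2Cor
import HarnessLib

/-!
# A projective image containing an element of order divisible by a prime `t > 5` is not
# icosahedral (Khare–Wintenberger (I), §6, proof of Lemma 6.3 (i))

Topic `Literature/NumberTheory/GaloisRepresentations`; theorems only (vocabulary of
`ProjectiveType.lean`: `projectiveImage`, `IsIcosahedralType`).  In the proof of Lemma 6.3 (i)
of *Serre's modularity conjecture (I)* (a locally good-dihedral `ρ̄` has non-solvable image,
projectively not `A₅`), Khare–Wintenberger argue: `ρ̄|_{I_q} = ψ ⊕ ψ^q` with `ψ` of order a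
power of a prime `t > max(r, p, 5)`, so the projective image of `ρ̄` contains an element of
order a non-trivial power of `t`, and

> As `t > 5`, we see that the projective image cannot be `A₅`.

The group theory behind this sentence is recorded here: `|A₅| = 60 = 2² · 3 · 5`
(the tree's `Serre1972.natCard_alternatingGroup_fin_five`), so no element of a group isomorphic
to `A₅` has order
divisible by a prime `t > 5` (`not_dvd_orderOf_of_mulEquiv_alternatingGroup_five`); hence a
representation whose projective image contains such an element is not of icosahedral type
(`not_isIcosahedralType_of_prime_dvd_orderOf`,
`KhareWintenberger2009.not_isIcosahedralType_of_orderOf_eq_prime_pow`).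

## References

* C. Khare, J.-P. Wintenberger, *Serre's modularity conjecture (I)*, Invent. Math. 178 (2009),
  485–504, §6, proof of Lemma 6.3 (i). [KhareWintenberger2009]
-/

open scoped MatrixGroups

namespace Literature.NumberTheory.GaloisRepresentations

/-- A prime `t > 5` divides the order of no element of a group isomorphic to `A₅`
(`|A₅| = 60 = 2² · 3 · 5`). [folklore] -/
theorem not_dvd_orderOf_of_mulEquiv_alternatingGroup_five {H : Type*} [Group H]
    (e : H ≃* alternatingGroup (Fin 5)) {t : ℕ} (ht : t.Prime) (h5 : 5 < t) (x : H) :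
    ¬ t ∣ orderOf x := by
  intro hdvd
  have h60 : orderOf x ∣ 60 := by
    rw [← Serre1972.natCard_alternatingGroup_fin_five, ← Nat.card_congr e.toEquiv]
    exact orderOf_dvd_natCard x
  have h2 : t ∣ 60 := hdvd.trans h60
  have hle : t ≤ 60 := Nat.le_of_dvd (by norm_num) h2
  interval_cases t <;> first | omega | exact absurd ht (by decide)

variable {G : Type*} [Group G] {n : Type*} [Fintype n] [DecidableEq n] {R : Type*} [CommRing R]
  {ρ : G →* GL n R}

/-- **A projective image with an element of order divisible by a prime `t > 5` is not `A₅`.**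
[cite: KhareWintenberger2009, §6, proof of Lemma 6.3 (i)] -/
theorem not_isIcosahedralType_of_prime_dvd_orderOf {x : PGL(n, R)} (hx : x ∈ projectiveImage ρ)
    {t : ℕ} (ht : t.Prime) (h5 : 5 < t) (hdvd : t ∣ orderOf x) : ¬ IsIcosahedralType ρ := by
  rintro ⟨e⟩
  refine not_dvd_orderOf_of_mulEquiv_alternatingGroup_five e ht h5 ⟨x, hx⟩ ?_
  rwa [← Subgroup.orderOf_mk] at hdvd

end Literature.NumberTheory.GaloisRepresentations

namespace Literature.NumberTheory.GaloisRepresentations.KhareWintenberger2009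

variable {G : Type*} [Group G] {n : Type*} [Fintype n] [DecidableEq n] {R : Type*} [CommRing R]
  {ρ : G →* GL n R}

/-- **Khare–Wintenberger (I), proof of Lemma 6.3 (i): "As `t > 5`, we see that the projective
image cannot be `A₅`."**  If for some `g` the image of `ρ(g)` in `PGL_n(R)` has order `t^b`
with `t > 5` prime and `b ≥ 1` (in the paper: `g` a generator of the image of inertia at the
good-dihedral prime `q`, acting through `ψ/ψ^q` of order a non-trivial power of `t`), then `ρ`
is not of icosahedral type. [cite: KhareWintenberger2009, §6, proof of Lemma 6.3 (i)] -/
theorem not_isIcosahedralType_of_orderOf_eq_prime_pow (g : G) {t b : ℕ} (ht : t.Prime)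
    (h5 : 5 < t) (hb : 1 ≤ b) (hord : orderOf (Matrix.ProjGenLinGroup.mk (ρ g)) = t ^ b) :
    ¬ IsIcosahedralType ρ :=
  not_isIcosahedralType_of_prime_dvd_orderOf (mk_apply_mem_projectiveImage ρ g) ht h5
    (hord ▸ dvd_pow_self t (by omega))

end Literature.NumberTheory.GaloisRepresentations.KhareWintenberger2009
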